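import Summits.QuantumFields.BalabanUV.Beta.LinearizingChange267FromQ

/-!
# `T4Continuum.ShellMeasureAverageRemainder` — row S55 (analytic ∕ remainder half), THE GENERIC STEP: from «analytic on a
# ball, vanishing at 0, linearly bounded» (the output SHAPE of the owner's engines `ShellMeasureAverageAnalytic.
# chartAverage_*`, `ShellMeasureAverageAnalyticLoc.relChart_*`, `ShellMeasureAverageAnalyticB7.norm_Qtilde_le`) to the
# SHAPE of [B7] Prop. 3 (122)–(123): `Q = DQ(0) + C`, `C(0) = 0`, `DC(0) = 0` («Taylor's expansion begins with a
# second-order polynomial»), `‖C(A)‖ ≤ (2K/R)·‖A‖²`, `‖DQ(0)‖ ≤ K`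
(cell `pub-balaban`, sub-cell `t4`, spine estimate NE7c (node U5b); NE7c ROUND-2 crew `t4-ne7c-formalise-*`, seat
`b2b-balaban-t4-ne7c-formalise-leaf-03` (gen 3), co-holder of row S55 «analytic ∕ remainder half» (journal «S55-ANALYTIC
MINE» l.13844); ADDITIVE — imports row D4's `Beta/LinearizingChange267FromQ` (`nonlin`, `nonlin_sq_bound`,
`analyticOnNhd_nonlin`; cross-cell import as S46 `ShellMeasureLinearizedFromQ` does) ONLY; [folklore]; 0 def, 0 sorry, 0 cite)

HONEST FRAMING.  Finite four-torus programme, rung (B)+1 only — NOT infinite volume, NOT a mass gap, NOT the Clay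
problem, NOT summit progress.  NE7c NOT PRINTED, NOT PROVED; «NE7c ⇐ the named binders» (c3); NOTHING in the countdown
moves.  Pure [folklore] calculus (Cauchy estimate at the origin in the form row D4 already proved); nothing of
Bałaban's is instantiated here — the instance «`Q` = (1/i) log of the double-bar average (89)/(121) at a general regular
background» is the S55 reproduction proper (objects: leaf-05-g6; analyticity: the owner's S58 `BallWord` engine) and
lands separately under `Literature/…/B7Prop3General*`.  HONEST DEPENDENCY (cell, verbatim): continuum YM on T⁴ ⇐
BetaPertH ∧ nine spine estimates (0/9 proved); BetaPertH ⇐ (D1) ∧ (D4) ∧ CAP+tail; G-an2-4 gates asym, D1 and NE2/3/4.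

CONTENT, for `Q : E → F` between complex normed spaces, `0 < R`, `AnalyticOnNhd ℂ Q (ball 0 R)`, `Q 0 = 0`, and the
LINEAR bound `‖Q B‖ ≤ K‖B‖` on the ball (`0 ≤ K`):
* `norm_fderiv_zero_le_of_linear_bound` — `‖DQ(0)‖ ≤ K` (Mathlib `HasFDerivAt.le_of_lip'`);
* `norm_nonlin_le_of_linear_bound` — `‖Q B − DQ(0) B‖ ≤ (2K/R)·‖B‖²` on the ball (`nonlin_sq_bound` with `M_Q := K·R`);
* `hasFDerivAt_nonlin_zero` ∕ `fderiv_nonlin_zero` — the remainder `C := Q − DQ(0)` has `DC(0) = 0`, with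
  `nonlin_zero` («begins with a second-order polynomial») and `analyticOnNhd_nonlin` BY NAME from row D4;
* `prop3_shape_of_linear_bound` — the four facts bundled in the (122)–(123) reading: `∀ B ∈ ball 0 R,
  Q B = DQ(0) B + C B ∧ ‖C B‖ ≤ (2K/R)‖B‖²`, `‖DQ(0)‖ ≤ K`, `C 0 = 0`, `DC(0) = 0` — so that with the engines' constants
  `K ~ L`, `R ~ 1/L` the printed `C₁(d)·L²` is `2K/R`.
-/

noncomputable section

open Metric Set Filter
open scoped Topology

namespace Summit.QuantumFields.BalabanUV.T4Continuum.ShellMeasureAverageRemainder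

open Summit.QuantumFields.BalabanUV.Beta.LinearizingChange267FromQ (nonlin nonlin_zero nonlin_sq_bound
  analyticOnNhd_nonlin apply_eq_lin_add_nonlin)

variable {E F : Type*} [NormedAddCommGroup E] [NormedSpace ℂ E] [NormedAddCommGroup F] [NormedSpace ℂ F]
  [CompleteSpace F]
variable {Q : E → F} {R K : ℝ}

omit [CompleteSpace F] in
/-- **`‖DQ(0)‖ ≤ K` FROM THE LINEAR BOUND**: `Q` Fréchet-differentiable at `0`, `Q 0 = 0`, `‖Q B‖ ≤ K‖B‖` on `ball 0 R`
(`0 < R`, `0 ≤ K`) ⟹ the operator norm of `fderiv ℂ Q 0` is at most `K`. [folklore] -/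
theorem norm_fderiv_zero_le_of_linear_bound (hR : 0 < R) (hK : 0 ≤ K) (hQd : DifferentiableAt ℂ Q 0) (hQ0 : Q 0 = 0)
    (hQK : ∀ B ∈ ball (0 : E) R, ‖Q B‖ ≤ K * ‖B‖) : ‖fderiv ℂ Q 0‖ ≤ K := by
  refine hQd.hasFDerivAt.le_of_lip' hK ?_
  filter_upwards [ball_mem_nhds (0 : E) hR] with B hB
  rw [hQ0, sub_zero, sub_zero]
  exact hQK B hB

/-- **THE QUADRATIC REMAINDER FROM THE LINEAR BOUND**: `Q` analytic on `ball 0 R`, `Q 0 = 0`, `‖Q B‖ ≤ K‖B‖` there ⟹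
`‖Q B − DQ(0) B‖ ≤ (2K/R)·‖B‖²` on the ball (`nonlin_sq_bound` with `M_Q := K·R`). [folklore] -/
theorem norm_nonlin_le_of_linear_bound (hR : 0 < R) (hK : 0 ≤ K) (hQa : AnalyticOnNhd ℂ Q (ball 0 R))
    (hQ0 : Q 0 = 0) (hQK : ∀ B ∈ ball (0 : E) R, ‖Q B‖ ≤ K * ‖B‖) :
    ∀ B ∈ ball (0 : E) R, ‖nonlin Q B‖ ≤ 2 * K / R * ‖B‖ ^ 2 := by
  intro B hB
  have hM : ∀ z ∈ ball (0 : E) R, ‖Q z‖ ≤ K * R := fun z hz =>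
    (hQK z hz).trans (mul_le_mul_of_nonneg_left (le_of_lt (mem_ball_zero_iff.1 hz)) hK)
  have h := nonlin_sq_bound hR hQa.differentiableOn hM hQ0 B hB
  have hRR : 2 * (K * R) / R ^ 2 = 2 * K / R := by
    field_simp
  rw [hRR] at h
  exact h

omit [CompleteSpace F] in
/-- **`DC(0) = 0`** for the remainder `C := Q − DQ(0)` of a map differentiable at `0`. [folklore] -/
theorem hasFDerivAt_nonlin_zero (hQd : DifferentiableAt ℂ Q 0) :
    HasFDerivAt (nonlin Q) (0 : E →L[ℂ] F) 0 := by
  have h := hQd.hasFDerivAt.sub (fderiv ℂ Q 0).hasFDerivAt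
  rw [sub_self] at h
  exact h

omit [CompleteSpace F] in
/-- `fderiv ℂ (nonlin Q) 0 = 0`. [folklore] -/
theorem fderiv_nonlin_zero (hQd : DifferentiableAt ℂ Q 0) : fderiv ℂ (nonlin Q) 0 = 0 :=
  (hasFDerivAt_nonlin_zero hQd).fderiv

/-- **THE (122)–(123) SHAPE FROM «ANALYTIC, ZERO AT 0, LINEARLY BOUNDED»**: on `ball 0 R`, `Q = DQ(0) + C` with
`‖C B‖ ≤ (2K/R)‖B‖²`; `‖DQ(0)‖ ≤ K`; `C 0 = 0`; `DC(0) = 0`; `C` analytic on the ball (`C := nonlin Q`).  With the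
owner's constants for the printed average (`K = c(d)·L`, `R = 1/(c′(d)·L)`) the quadratic constant `2K/R` is
`C₁(d)·L²` — [Balaban1985Averaging] Prop. 3's «C₁ depends on d and c₃ depends on d and L» (locator only; the
instance is row S55's reproduction). [folklore] -/
theorem prop3_shape_of_linear_bound (hR : 0 < R) (hK : 0 ≤ K) (hQa : AnalyticOnNhd ℂ Q (ball 0 R)) (hQ0 : Q 0 = 0)
    (hQK : ∀ B ∈ ball (0 : E) R, ‖Q B‖ ≤ K * ‖B‖) :
    (∀ B ∈ ball (0 : E) R, Q B = fderiv ℂ Q 0 B + nonlin Q B ∧ ‖nonlin Q B‖ ≤ 2 * K / R * ‖B‖ ^ 2) ∧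
      ‖fderiv ℂ Q 0‖ ≤ K ∧ nonlin Q 0 = 0 ∧ fderiv ℂ (nonlin Q) 0 = 0 ∧ AnalyticOnNhd ℂ (nonlin Q) (ball 0 R) := by
  have hQd : DifferentiableAt ℂ Q 0 := (hQa 0 (mem_ball_self hR)).differentiableAt
  exact ⟨fun B hB => ⟨apply_eq_lin_add_nonlin Q B, norm_nonlin_le_of_linear_bound hR hK hQa hQ0 hQK B hB⟩,
    norm_fderiv_zero_le_of_linear_bound hR hK hQd hQ0 hQK, nonlin_zero hQ0, fderiv_nonlin_zero hQd,
    analyticOnNhd_nonlin hQa⟩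

end Summit.QuantumFields.BalabanUV.T4Continuum.ShellMeasureAverageRemainder

end
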